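import Literature.Barriers.FinalStateConjecture.TrappingDerivativeLossGeodesicBeams
import HarnessLib

/-!
# Gaussian beams along a null geodesic of Kerr, I: the geodesic in the Kerr–Schild chart

(first proof file towards `KerrNullGeodesicGaussianBeams_holds`,
`Literature/Barriers/FinalStateConjecture/TrappingDerivativeLossGeodesicBeams.lean`; family `gr`,
summit `FinalStateConjecture`; namespace `Literature.Barriers.FinalStateConjecture.GaussianBeam`)

Sbierski's construction of Gaussian beams (Anal. PDE 8 (2015) 1379, §3 = arXiv:1311.2477 §2.2)
starts from an affinely parametrised null geodesic `γ` *read in a coordinate chart*: the data of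
the beam are the curve `x(s)`, the momentum `p(s) = γ̇♭(s)` ("`dφ(s) := γ̇♭(s)`", (2.14) of the
arXiv text) and the geodesic/Hamiltonian equations they satisfy. The named fact
`KerrNullGeodesicGaussianBeams` hands us `γ : ℝ → Kerr.exterior M a` only through the abstract
predicate `IsGeodesic (Kerr.smoothMetric M a r₊).leviCivita γ` of `Geodesic.lean`. This file
extracts the chart data:

* `GaussianBeam.hasDerivAt_of_isGeodesicOn` — **the geodesic equations in the chart `U`,
  necessity** (O'Neill 1983, Ch. 3, Cor. 21, "only if"; the converse of
  `OpensChart.isGeodesicOn_of_hasDerivAt`): along a geodesic of a metric with differentiable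
  components `G` on an open subset `U` of a normed space, the coordinate curve `c = val ∘ γ` has
  derivative the velocity `γ'`, and `γ'` has derivative `−Γ_{γ t}(γ', γ')`
  (`OpensChart.christoffel`), read off `hasDerivAt_oneJet_of_covariantDerivAlong_eq_zero`
  (`GeodesicProofs.lean`) in the identity trivialisation of `TU`;
* `GaussianBeam.christoffelVec` — the Christoffel map of the Kerr–Schild components as a plain
  map `E4 → E4 → E4 → E4`, `Γ_x(Y, X) = g♯(½ K_x(Y, X, ·))` with the explicit inverse
  `Kerr.coSharp` (`christoffel_eq_christoffelVec`, components `christoffelVec_apply` through the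
  first-kind symbols `koszulHalf`), and its smoothness on `{r > 0}` along smooth data
  (`contDiffAt_fderiv_bilin`, `contDiffAt_koszulHalf`, `contDiffAt_christoffelVec`);
* `GaussianBeam.contDiff_of_hasDerivAt` — the regularity bootstrap for `Z' = G(t, Z)` with `G`
  smooth along the solution;
* `GaussianBeam.geodesic_hasDerivAt`, `geodesic_contDiff` — for a geodesic `γ` of the Kerr
  exterior: `c' = γ'`, `γ'' = −Γ_c(γ', γ')`, and **`c`, `γ'` are `C^∞`** (bootstrap: `c'' = F(c, c')`
  with `F` smooth).

Everything here is proved; no named facts are introduced. The sequel files build, from these chart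
data, the momentum `p = g(γ', ·)`, Hamilton's equations and the Jacobi/Riccati data of the phase
(`Literature/Analysis/ODE/GaussianBeamRiccatiExistence.lean`).

## References

* J. Sbierski, Anal. PDE 8 (2015) 1379–1420 (arXiv:1311.2477), §2.2 of the arXiv text
  (key `Sbierski2015`).
* B. O'Neill, *Semi-Riemannian geometry*, Academic Press 1983, Ch. 3, Prop. 13, Cor. 21
  (key `ONeill1983`).
-/

noncomputable section

open Bundle Set Filter Function TopologicalSpace
open scoped Manifold ContDiff Topology

namespace Literature.Barriers.FinalStateConjecture

namespace GaussianBeam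

open Literature.Geometry.Lorentzian

/-! ### The geodesic equations in a chart `U : Opens E`, necessity -/

section OpensChart

variable {E : Type*} [NormedAddCommGroup E] [NormedSpace ℝ E] [FiniteDimensional ℝ E]
  {U : Opens E} {n : ℕ∞ω}
  {g : PseudoRiemannianMetric 𝓘(ℝ, E) n E (TangentSpace 𝓘(ℝ, E) : U → Type _)}
  {G : E → E →L[ℝ] E →L[ℝ] ℝ}

/-- **The geodesic equations in the chart `U`, necessity** (O'Neill 1983, Ch. 3, Cor. 21, p. 67:
"`γ` is a geodesic if and only if `(xᵏ ∘ γ)'' + ∑ Γᵏᵢⱼ (xⁱ ∘ γ)' (xʲ ∘ γ)' = 0`", the "only if"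
direction; converse of `OpensChart.isGeodesicOn_of_hasDerivAt`). Let `g` be a `C^n` metric on
`U : Opens E` with its Levi-Civita connection and with components `G` (`g.val y = G y`)
differentiable at every point, and let `γ : ℝ → U` be a geodesic of `g.leviCivita` on `s`. Then at
every `t ∈ s` the coordinate curve `t ↦ (γ t : E)` has derivative the velocity `γ'(t)`, and the
velocity has derivative `−Γ_{γ t}(γ'(t), γ'(t))`, `Γ` the Christoffel map `OpensChart.christoffel`
of the components. [cite: ONeill1983, Ch. 3, Cor. 21] -/
theorem hasDerivAt_of_isGeodesicOn [g.HasLeviCivita] (hG : ∀ y : U, g.val y = G y)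
    (hGd : ∀ y : U, DifferentiableAt ℝ G y) {γ : ℝ → U} {s : Set ℝ}
    (hγ : IsGeodesicOn g.leviCivita γ s) {t : ℝ} (ht : t ∈ s) :
    HasDerivAt (fun t' ↦ (γ t' : E)) (velocity 𝓘(ℝ, E) γ t) t ∧
      HasDerivAt (fun t' ↦ (velocity 𝓘(ℝ, E) γ t' : E))
        (-OpensChart.christoffel g G (γ t) (velocity 𝓘(ℝ, E) γ t) (velocity 𝓘(ℝ, E) γ t)) t := by
  set x₁ : U := γ t with hx₁
  set b := Module.finBasis ℝ E with hb
  set Ĉ : Fin (Module.finrank ℝ E) → U → (E →L[ℝ] E) :=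
    fun i y ↦ OpensChart.christoffel g G y (b i) with hĈ_def
  have hN : (univ : Set U) ⊆ (chartAt E x₁).source := fun y _ ↦ by
    simp [OpensChart.chartAt_source]
  have hĈ : ∀ y ∈ (univ : Set U), ∀ (i) (w : TangentSpace 𝓘(ℝ, E) y),
      Ĉ i y ((trivializationAt E (TangentSpace 𝓘(ℝ, E)) x₁).continuousLinearMapAt ℝ y w) =
        ((trivializationAt E (TangentSpace 𝓘(ℝ, E)) x₁)
          ⟨y, g.leviCivita ((trivializationAt E (TangentSpace 𝓘(ℝ, E)) x₁).localFrame b i)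
            y w⟩).2 := by
    intro y _ i w
    rw [OpensChart.continuousLinearMapAt_trivializationAt_apply,
      OpensChart.trivializationAt_apply, OpensChart.localFrame_trivializationAt]
    exact (OpensChart.leviCivita_const_apply hG y (hGd y) (b i) w).symm
  have h := hasDerivAt_oneJet_of_covariantDerivAlong_eq_zero (cov := g.leviCivita) b hN Ĉ hĈ
    (mem_univ (γ t)) (hγ.1 t ht) (hγ.2 t ht)
  have hU : ∀ t', ((trivializationAt E (TangentSpace 𝓘(ℝ, E)) x₁)
      (tangentLift 𝓘(ℝ, E) γ t')).2 = velocity 𝓘(ℝ, E) γ t' := fun t' ↦ by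
    rw [show tangentLift 𝓘(ℝ, E) γ t' = ⟨γ t', velocity 𝓘(ℝ, E) γ t'⟩ from rfl,
      OpensChart.trivializationAt_apply]
  have hφ : ∀ t', extChartAt 𝓘(ℝ, E) x₁ (γ t') = (γ t' : E) := fun t' ↦
    OpensChart.extChartAt_apply x₁ (γ t')
  simp only [hU, hφ] at h
  have hsum : ∑ i, b.repr (velocity 𝓘(ℝ, E) γ t) i • Ĉ i (γ t) (velocity 𝓘(ℝ, E) γ t) =
      OpensChart.christoffel g G (γ t) (velocity 𝓘(ℝ, E) γ t) (velocity 𝓘(ℝ, E) γ t) := by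
    simp only [hĈ_def]
    rw [← OpensChart.christoffel_sum, b.sum_repr]
  rw [hsum] at h
  refine ⟨?_, ?_⟩
  · exact (ContinuousLinearMap.fst ℝ E E).hasFDerivAt.comp_hasDerivAt t h
  · exact (ContinuousLinearMap.snd ℝ E E).hasFDerivAt.comp_hasDerivAt t h

end OpensChart

/-! ### The Christoffel map of the Kerr–Schild components as a plain map, and its smoothness -/

section KerrChart

/-- Half the Koszul form of the Kerr–Schild components, as a scalar function of the point `x`, the
two vector slots `Y, X` and the test vector `v`:
`½ K_x(Y, X, v) = ½ (∂_X g(Y, v) + ∂_Y g(v, X) − ∂_v g(X, Y))` (O'Neill 1983, Ch. 3, proof of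
Prop. 13), i.e. the Christoffel symbol of the first kind `Γ_{v X Y}` of `g_{M,a} = η + 2H ℓ ⊗ ℓ`.
[cite: ONeill1983, Ch. 3, Prop. 3.13] -/
def koszulHalf (M a : ℝ) (x Y X v : E4) : ℝ :=
  2⁻¹ * (fderiv ℝ (Kerr.bilin M a) x X Y v + fderiv ℝ (Kerr.bilin M a) x Y v X -
    fderiv ℝ (Kerr.bilin M a) x v X Y)

/-- `½ K_x(Y, X, ·)` is the linear functional `(2⁻¹ • koszulForm (Kerr.bilin M a) x Y) X` of
`ChartCalculus.lean`. [cite: ONeill1983, Ch. 3, Prop. 3.13] -/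
theorem smul_koszulForm_apply (M a : ℝ) (x Y X v : E4) :
    ((2 : ℝ)⁻¹ • OpensChart.koszulForm (Kerr.bilin M a) x Y X) v = koszulHalf M a x Y X v := by
  simp only [LinearMap.smul_apply, OpensChart.koszulForm_apply, smul_eq_mul, koszulHalf]

/-- **The Christoffel map of the Kerr–Schild components as a plain map** `E4 → E4 → E4 → E4`:
`Γ_x(Y, X) = g♯(½ K_x(Y, X, ·))` with the explicit inverse `g♯p = η♯p − 2H p(ℓ♯) ℓ♯`
(`Kerr.coSharp`), defined for every `x ∈ E4` (meaningful where `r > 0`). O'Neill 1983, Ch. 3,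
Prop. 13; Kerr–Schild 1965, §2 (the inverse metric). [cite: ONeill1983, Ch. 3, Prop. 3.13] -/
def christoffelVec (M a : ℝ) (x Y X : E4) : E4 :=
  Kerr.coSharp M a x ((2 : ℝ)⁻¹ • OpensChart.koszulForm (Kerr.bilin M a) x Y X)

/-- On a Kerr–Schild chart domain the Christoffel map `OpensChart.christoffel` of the smooth Kerr
metric with components `Kerr.bilin M a` is `christoffelVec` (the musical isomorphism of the Kerr
metric is `Kerr.coSharp`, `Kerr.sharp_smoothMetric`). [cite: KerrSchild1965, §2] -/
theorem christoffel_eq_christoffelVec [Kerr.Facts] (M a r₀ : ℝ) (x : Kerr.region a r₀)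
    (Y X : E4) :
    OpensChart.christoffel (Kerr.smoothMetric M a r₀).toPseudoRiemannianMetric (Kerr.bilin M a) x
        Y X = christoffelVec M a x Y X := by
  rw [OpensChart.christoffel_apply]
  exact Kerr.sharp_smoothMetric M a r₀ x _

/-- Components of `christoffelVec`: `Γ_x(Y, X)^μ = (η♯P)^μ − 2H P(ℓ♯) (ℓ♯)^μ` with
`P = ½ K_x(Y, X, ·)`, `(η♯P)^0 = −P(∂₀)`, `(η♯P)^i = P(∂_i)`. [cite: KerrSchild1965, §2] -/
theorem christoffelVec_apply (M a : ℝ) (x Y X : E4) (μ : Fin 4) :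
    christoffelVec M a x Y X μ =
      (if μ = 0 then -koszulHalf M a x Y X (E4.basisVector 0)
        else koszulHalf M a x Y X (E4.basisVector μ)) -
      2 * Kerr.scalarH M a x * koszulHalf M a x Y X (Kerr.nullVector a x) *
        Kerr.nullVector a x μ := by
  simp only [christoffelVec, Kerr.coSharp, Kerr.etaSharp, smul_koszulForm_apply, PiLp.sub_apply,
    PiLp.smul_apply, smul_eq_mul]

/-- **Smoothness of `∂g` along smooth data**: if `ξ, X, Y, v` are `C^{n+1}` at `q₀` and
`r(ξ q₀) > 0`, then `q ↦ ∂_{X q} g_{ξ q}(Y q, v q)` is `C^n` at `q₀` (the Kerr–Schild components are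
real-analytic on `{r > 0}`, `Kerr.contDiffAt_bilin`; the derivative is read as the partial
derivative of the scalar family `(q, y) ↦ g_y(Y q, v q)`). [cite: KerrSchild1965, §3] -/
theorem contDiffAt_fderiv_bilin (M a : ℝ) {n : WithTop ℕ∞} {F : Type*} [NormedAddCommGroup F]
    [NormedSpace ℝ F] {q₀ : F} {ξ X Y v : F → E4} (hξ : ContDiffAt ℝ (n + 1) ξ q₀)
    (hr : 0 < Kerr.radius a (ξ q₀)) (hX : ContDiffAt ℝ (n + 1) X q₀)
    (hY : ContDiffAt ℝ (n + 1) Y q₀) (hv : ContDiffAt ℝ (n + 1) v q₀) :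
    ContDiffAt ℝ n (fun q ↦ fderiv ℝ (Kerr.bilin M a) (ξ q) (X q) (Y q) (v q)) q₀ := by
  have hf : ContDiffAt ℝ (n + 1)
      (Function.uncurry fun (q : F) (y : E4) ↦ Kerr.bilin M a y (Y q) (v q)) (q₀, ξ q₀) := by
    have h1 : ContDiffAt ℝ (n + 1) (Kerr.bilin M a ∘ Prod.snd) (q₀, ξ q₀) :=
      (Kerr.contDiffAt_bilin M a hr).comp (q₀, ξ q₀) contDiffAt_snd
    exact (h1.clm_apply (hY.comp (q₀, ξ q₀) contDiffAt_fst)).clm_apply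
      (hv.comp (q₀, ξ q₀) contDiffAt_fst)
  have h2 : ContDiffAt ℝ n
      (fun q ↦ fderiv ℝ (fun y ↦ Kerr.bilin M a y (Y q) (v q)) (ξ q)) q₀ :=
    hf.fderiv (hξ.of_le le_self_add) le_rfl
  have h3 : ContDiffAt ℝ n
      (fun q ↦ fderiv ℝ (fun y ↦ Kerr.bilin M a y (Y q) (v q)) (ξ q) (X q)) q₀ :=
    h2.clm_apply (hX.of_le le_self_add)
  have hev : ∀ᶠ q in 𝓝 q₀, 0 < Kerr.radius a (ξ q) :=
    hξ.continuousAt.preimage_mem_nhds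
      ((isOpen_lt continuous_const (Kerr.continuous_radius a)).mem_nhds hr)
  refine h3.congr_of_eventuallyEq ?_
  filter_upwards [hev] with q hq
  exact (OpensChart.fderiv_apply₂ (Kerr.bilin M a)
    ((Kerr.contDiffAt_bilin M a hq (n := 1)).differentiableAt one_ne_zero) (Y q) (v q) (X q)).symm

/-- Smoothness of `½ K` along smooth data: if `ξ, Y, X, v` are `C^{n+1}` at `q₀` and
`r(ξ q₀) > 0`, then `q ↦ ½ K_{ξ q}(Y q, X q, v q)` is `C^n` at `q₀`. [cite: KerrSchild1965, §3] -/
theorem contDiffAt_koszulHalf (M a : ℝ) {n : WithTop ℕ∞} {F : Type*} [NormedAddCommGroup F]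
    [NormedSpace ℝ F] {q₀ : F} {ξ Y X v : F → E4} (hξ : ContDiffAt ℝ (n + 1) ξ q₀)
    (hr : 0 < Kerr.radius a (ξ q₀)) (hY : ContDiffAt ℝ (n + 1) Y q₀)
    (hX : ContDiffAt ℝ (n + 1) X q₀) (hv : ContDiffAt ℝ (n + 1) v q₀) :
    ContDiffAt ℝ n (fun q ↦ koszulHalf M a (ξ q) (Y q) (X q) (v q)) q₀ := by
  unfold koszulHalf
  exact contDiffAt_const.mul (((contDiffAt_fderiv_bilin M a hξ hr hX hY hv).add
    (contDiffAt_fderiv_bilin M a hξ hr hY hv hX)).sub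
    (contDiffAt_fderiv_bilin M a hξ hr hv hX hY))

/-- **Smoothness of the Christoffel map of Kerr** along smooth data: if `ξ, Y, X` are `C^{n+1}`
at `q₀` and `r(ξ q₀) > 0`, then `q ↦ Γ_{ξ q}(Y q, X q)` is `C^n` at `q₀` (components: `H`, `ℓ♯`
and `∂g` are real-analytic on `{r > 0}`; Kerr–Schild 1965, §3). [cite: KerrSchild1965, §3] -/
theorem contDiffAt_christoffelVec (M a : ℝ) {n : WithTop ℕ∞} {F : Type*} [NormedAddCommGroup F]
    [NormedSpace ℝ F] {q₀ : F} {ξ Y X : F → E4} (hξ : ContDiffAt ℝ (n + 1) ξ q₀)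
    (hr : 0 < Kerr.radius a (ξ q₀)) (hY : ContDiffAt ℝ (n + 1) Y q₀)
    (hX : ContDiffAt ℝ (n + 1) X q₀) :
    ContDiffAt ℝ n (fun q ↦ christoffelVec M a (ξ q) (Y q) (X q)) q₀ := by
  have hH : ContDiffAt ℝ n (fun q ↦ Kerr.scalarH M a (ξ q)) q₀ :=
    (Kerr.contDiffAt_scalarH M a hr).comp q₀ (hξ.of_le le_self_add)
  have hℓ : ContDiffAt ℝ (n + 1) (fun q ↦ Kerr.nullVector a (ξ q)) q₀ :=
    (Kerr.contDiffAt_nullVector a hr).comp q₀ hξ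
  have hℓμ : ∀ μ, ContDiffAt ℝ n (fun q ↦ Kerr.nullVector a (ξ q) μ) q₀ := fun μ ↦
    contDiffAt_euclidean.1 (hℓ.of_le le_self_add) μ
  rw [contDiffAt_euclidean]
  intro μ
  simp only [christoffelVec_apply]
  refine ContDiffAt.sub ?_ (((contDiffAt_const.mul hH).mul
    (contDiffAt_koszulHalf M a hξ hr hY hX hℓ)).mul (hℓμ μ))
  split_ifs
  · exact (contDiffAt_koszulHalf M a hξ hr hY hX contDiffAt_const).neg
  · exact contDiffAt_koszulHalf M a hξ hr hY hX contDiffAt_const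

end KerrChart

/-! ### A geodesic of the Kerr exterior in the Kerr–Schild chart -/

section KerrGeodesic

variable [Kerr.Facts] [Kerr.SliceFacts]

/-- **The geodesic equations of the Kerr exterior in the ingoing Kerr–Schild chart.** For a
geodesic `γ` of the Levi-Civita connection of `Kerr.smoothMetric M a r₊` on the exterior, the
coordinate curve `x(s) = (γ s : E4)` has derivative the velocity `γ'(s)` and
`(γ')' (s) = −Γ_{x(s)}(γ'(s), γ'(s))` (`christoffelVec`). O'Neill 1983, Ch. 3, Cor. 21; this is the
form "`γ̇` satisfies the equations of the geodesic flow" used by Sbierski, arXiv:1311.2477, §2.2.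
[cite: ONeill1983, Ch. 3, Cor. 21] -/
theorem geodesic_hasDerivAt (M a : ℝ) {γ : ℝ → Kerr.exterior M a}
    (hγ : IsGeodesic (Kerr.smoothMetric M a (Kerr.rPlus M a)).leviCivita γ) (t : ℝ) :
    HasDerivAt (fun t' ↦ (γ t' : E4)) (velocity 𝓘(ℝ, E4) γ t) t ∧
      HasDerivAt (fun t' ↦ (velocity 𝓘(ℝ, E4) γ t' : E4))
        (-christoffelVec M a (γ t) (velocity 𝓘(ℝ, E4) γ t) (velocity 𝓘(ℝ, E4) γ t)) t := by
  have h := hasDerivAt_of_isGeodesicOn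
    (g := (Kerr.smoothMetric M a (Kerr.rPlus M a)).toPseudoRiemannianMetric)
    (G := Kerr.bilin M a) (fun _ ↦ rfl) (fun y ↦ Kerr.differentiableAt_bilin M a y)
    (hγ.isGeodesicOn univ) (mem_univ t)
  rwa [christoffel_eq_christoffelVec] at h

omit [Kerr.Facts] [Kerr.SliceFacts] in
/-- **Regularity bootstrap for a first-order ODE**: a solution `Z` of `Z' = G(t, Z)` on `ℝ` with
`G` of class `C^k` at the points `(t, Z t)` for every `k` is `C^∞` (induction on `k`:
`Z ∈ C^k ⇒ Z' = G ∘ (id, Z) ∈ C^k ⇒ Z ∈ C^{k+1}`). Standard (e.g. the smoothness of geodesics,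
O'Neill 1983, Ch. 3, Lemma 22). [folklore] -/
theorem contDiff_of_hasDerivAt {V : Type*} [NormedAddCommGroup V] [NormedSpace ℝ V]
    {Z : ℝ → V} {G : ℝ × V → V} (hZ : ∀ t, HasDerivAt Z (G (t, Z t)) t)
    (hG : ∀ (k : ℕ) (t : ℝ), ContDiffAt ℝ k G (t, Z t)) : ContDiff ℝ ∞ Z := by
  have hd : deriv Z = fun t ↦ G (t, Z t) := funext fun t ↦ (hZ t).deriv
  have key : ∀ k : ℕ, ContDiff ℝ k Z := by
    intro k
    induction k with
    | zero =>
        rw [Nat.cast_zero]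
        exact contDiff_zero.2 (continuous_iff_continuousAt.2 fun t ↦ (hZ t).continuousAt)
    | succ k ih =>
        rw [Nat.cast_succ, contDiff_succ_iff_deriv, hd]
        exact ⟨fun t ↦ (hZ t).differentiableAt, fun h ↦ absurd h (WithTop.natCast_ne_top k),
          contDiff_iff_contDiffAt.2 fun t ↦ (hG k t).comp t (contDiffAt_id.prodMk ih.contDiffAt)⟩
  exact contDiff_infty.2 key

/-- **A geodesic of the Kerr exterior is smooth in the chart**: its coordinate curve and its
velocity are `C^∞` functions `ℝ → E4`. The geodesic predicate only asks for two derivatives;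
smoothness is the usual bootstrap from the geodesic equations `x' = γ'`, `(γ')' = −Γ_x(γ', γ')`
with `Γ` smooth on `{r > 0}` (O'Neill 1983, Ch. 3, Cor. 21 with Lemma 22: geodesics are the
integral curves of a smooth vector field on `TM`). [cite: ONeill1983, Ch. 3, Cor. 21] -/
theorem geodesic_contDiff (M a : ℝ) {γ : ℝ → Kerr.exterior M a}
    (hγ : IsGeodesic (Kerr.smoothMetric M a (Kerr.rPlus M a)).leviCivita γ) :
    ContDiff ℝ ∞ (fun t ↦ (γ t : E4)) ∧ ContDiff ℝ ∞ (fun t ↦ (velocity 𝓘(ℝ, E4) γ t : E4)) := by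
  have hZ : ∀ t, HasDerivAt (fun t' ↦ ((γ t' : E4), (velocity 𝓘(ℝ, E4) γ t' : E4)))
      ((fun q : ℝ × (E4 × E4) ↦ (q.2.2, -christoffelVec M a q.2.1 q.2.2 q.2.2))
        (t, ((γ t : E4), (velocity 𝓘(ℝ, E4) γ t : E4)))) t := fun t ↦
    (geodesic_hasDerivAt M a hγ t).1.prodMk (geodesic_hasDerivAt M a hγ t).2
  have hΓ : ∀ (k : ℕ) (t : ℝ), ContDiffAt ℝ k
      (fun q : ℝ × (E4 × E4) ↦ christoffelVec M a q.2.1 q.2.2 q.2.2)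
      (t, ((γ t : E4), (velocity 𝓘(ℝ, E4) γ t : E4))) := fun k t ↦
    contDiffAt_christoffelVec M a (n := k) contDiffAt_snd.fst
      (Kerr.radius_pos_of_mem_region (γ t).2) contDiffAt_snd.snd contDiffAt_snd.snd
  have hG : ∀ (k : ℕ) (t : ℝ), ContDiffAt ℝ k
      (fun q : ℝ × (E4 × E4) ↦ (q.2.2, -christoffelVec M a q.2.1 q.2.2 q.2.2))
      (t, ((γ t : E4), (velocity 𝓘(ℝ, E4) γ t : E4))) := fun k t ↦
    contDiffAt_snd.snd.prodMk (hΓ k t).neg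
  have h := contDiff_of_hasDerivAt hZ hG
  have h1 : ContDiff ℝ ∞ (fun t ↦ (γ t : E4)) := ContDiff.fst h
  have h2 : ContDiff ℝ ∞ (fun t ↦ (velocity 𝓘(ℝ, E4) γ t : E4)) := ContDiff.snd h
  exact ⟨h1, h2⟩

end KerrGeodesic

end GaussianBeam

end Literature.Barriers.FinalStateConjecture

end
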